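import Mathlib
import Summits.Ventures.PercRepro2.CoinChainXAGateBridge
import Summits.Ventures.PercRepro2.CoinChainXAMjGate
import Summits.Ventures.PercRepro2.CoinChainXAMGateFacts
import Summits.Ventures.PercRepro2.CoinChainXAMGateThree

/-!
# EVERY M-supported gate of the chain reduces to the sixth corner (M⁻)
(blind cell PercRepro2, night-2 g31; proofs/NIGHT2-DARC.md §73.6)

`chain_XA'_mgate_of_mminus`: for `ent = {m}`, ANY `ent' ∋ j, j'`, the entry markers, and ANY gate `d'` that
vanishes off the sure-entered clusters (`m ∉ W → d' W = 0`) under the standing hypotheses (`d'` log-supermodular,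
`d' ≤ d`, `(d, d')` cross-log-supermodular — no ratio hypothesis on `d'` is needed), with positive `d`-masses on the
four cells of the sure-entered clusters and the (M⁻) inequality `HMM` of `mgate_of_mminus` in the chain's region
sums, the cleared (XA′) holds.  So the general M-supported gate of the three-coin pair is pinned on ONE polynomial
inequality in the eleven base parts — the both-open corner `(x2, y2)` of §72.13 at `ω = XYM`, `r∅ = rₓ·r_y/ω`.
Proof: the bridge `chain_XA'_gate_of_parts`, the vanishing of the gate on `D′`, the base facts of the five
corners (as in `chain_XA'_mj_gate` and `chain_XA'_top_gate`), the gate's cell facts (`mg_fact_ratio0x`,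
`mg_fact_ratiox`, `mg_fact_hyp`, `mg_fact_IM`) and `mgate_of_mminus`.
-/

namespace Summit.Ventures.PercRepro2.Coin

open Classical

section MGateChainSums

variable {V : Type*} [DecidableEq V] {R : Type*} [Field R]
variable (U : Finset V) (P : Finset V → Prop) [DecidablePred P] (f x y : Finset V → R)

omit [DecidableEq V] in
/-- The unmarked cell sum. -/
theorem mg_cell00 :
    ∑ W ∈ U.powerset.filter P, f W * ((1 - x W) * (1 - y W)) =
      (∑ W ∈ U.powerset.filter P, f W) - (∑ W ∈ U.powerset.filter P, f W * x W)
        - (∑ W ∈ U.powerset.filter P, f W * y W) + (∑ W ∈ U.powerset.filter P, f W * (x W * y W)) := by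
  rw [← Finset.sum_sub_distrib, ← Finset.sum_sub_distrib, ← Finset.sum_add_distrib]
  exact Finset.sum_congr rfl (fun W _ => by ring)

omit [DecidableEq V] in
/-- The `x`-only cell sum. -/
theorem mg_cellx0 :
    ∑ W ∈ U.powerset.filter P, f W * (x W * (1 - y W)) =
      (∑ W ∈ U.powerset.filter P, f W * x W) - (∑ W ∈ U.powerset.filter P, f W * (x W * y W)) := by
  rw [← Finset.sum_sub_distrib]
  exact Finset.sum_congr rfl (fun W _ => by ring)

omit [DecidableEq V] in
/-- The `y`-only cell sum. -/
theorem mg_cell0y :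
    ∑ W ∈ U.powerset.filter P, f W * ((1 - x W) * y W) =
      (∑ W ∈ U.powerset.filter P, f W * y W) - (∑ W ∈ U.powerset.filter P, f W * (x W * y W)) := by
  rw [← Finset.sum_sub_distrib]
  exact Finset.sum_congr rfl (fun W _ => by ring)

omit [DecidableEq V] in
/-- The `y`-marked `x`-unmarked cell sum (the other spelling). -/
theorem mg_cell0y' :
    ∑ W ∈ U.powerset.filter P, f W * (y W * (1 - x W)) =
      (∑ W ∈ U.powerset.filter P, f W * y W) - (∑ W ∈ U.powerset.filter P, f W * (x W * y W)) := by
  rw [← Finset.sum_sub_distrib]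
  exact Finset.sum_congr rfl (fun W _ => by ring)

/-- A gate vanishing off the sure-entered clusters has no mass on the coin-entered ones. -/
theorem mg_gate_D (m : V) (ent' : Finset V) (ν d' z : Finset V → R) (hD : ∀ W, m ∉ W → d' W = 0) :
    ∑ W ∈ U.powerset.filter (fun W => (¬ ∃ r ∈ ({m} : Finset V), r ∈ W) ∧ ∃ r ∈ ent', r ∈ W), ν W * d' W * z W = 0 :=
  Finset.sum_eq_zero (fun W hW => by
    have h := (Finset.mem_filter.1 hW).2
    rw [hD W (fun hm => h.1 ⟨m, Finset.mem_singleton_self m, hm⟩)]; ring)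

/-- A gate vanishing off the sure-entered clusters has no mass on the coin-entered ones (no weight). -/
theorem mg_gate_D' (m : V) (ent' : Finset V) (ν d' : Finset V → R) (hD : ∀ W, m ∉ W → d' W = 0) :
    ∑ W ∈ U.powerset.filter (fun W => (¬ ∃ r ∈ ({m} : Finset V), r ∈ W) ∧ ∃ r ∈ ent', r ∈ W), ν W * d' W = 0 :=
  Finset.sum_eq_zero (fun W hW => by
    have h := (Finset.mem_filter.1 hW).2
    rw [hD W (fun hm => h.1 ⟨m, Finset.mem_singleton_self m, hm⟩)]; ring)

end MGateChainSums

section MGateChainMain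

variable {V : Type*} [DecidableEq V] {R : Type*} [Field R] [LinearOrder R] [IsStrictOrderedRing R]

set_option maxHeartbeats 12000000 in
/-- **EVERY M-SUPPORTED GATE OF THE CHAIN REDUCES TO (M⁻)**: for `ent = {m}`, any `ent' ∋ j, j'`, the entry
markers and any gate `d'` vanishing off the `m`-clusters, with positive `d`-masses on the four cells of the
`m`-clusters and the (M⁻) inequality in the region sums, the cleared (XA′) holds. -/
theorem chain_XA'_mgate_of_mminus (U : Finset V) (m j j' : V) (ent' : Finset V) (ν c d d' : Finset V → R)
    (hj : j ∈ ent') (hj' : j' ∈ ent')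
    (hν0 : ∀ W, 0 ≤ ν W) (hν : ∀ s ⊆ U, ∀ t ⊆ U, ν s * ν t ≤ ν (s ∩ t) * ν (s ∪ t))
    (hc0 : ∀ W, 0 ≤ c W) (hd0 : ∀ W, 0 ≤ d W) (hdc : ∀ W, d W ≤ c W)
    (hcd : ∀ s t, c s * d t ≤ c (s ∩ t) * d (s ∪ t))
    (hratio : ∀ s t, s ⊆ t → d s * c t ≤ c s * d t)
    (hdd : ∀ s t, d s * d t ≤ d (s ∩ t) * d (s ∪ t))
    (hd'0 : ∀ W, 0 ≤ d' W) (hd'd : ∀ W, d' W ≤ d W)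
    (hd'd' : ∀ s t, d' s * d' t ≤ d' (s ∩ t) * d' (s ∪ t))
    (hdd' : ∀ s t, d s * d' t ≤ d (s ∩ t) * d' (s ∪ t))
    (hD : ∀ W, m ∉ W → d' W = 0)
    (x y : Finset V → R) (hx : ∀ W, x W = if j ∈ W then 1 else 0) (hy : ∀ W, y W = if j' ∈ W then 1 else 0)
    (hbpos : 0 < ∑ W ∈ U.powerset.filter (fun W => ∃ r ∈ ({m} : Finset V), r ∈ W), ν W * d W * ((1 - x W) * (1 - y W)))
    (hb1pos : 0 < ∑ W ∈ U.powerset.filter (fun W => ∃ r ∈ ({m} : Finset V), r ∈ W), ν W * d W * (x W * (1 - y W)))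
    (hb2pos : 0 < ∑ W ∈ U.powerset.filter (fun W => ∃ r ∈ ({m} : Finset V), r ∈ W), ν W * d W * ((1 - x W) * y W))
    (hb12pos : 0 < ∑ W ∈ U.powerset.filter (fun W => ∃ r ∈ ({m} : Finset V), r ∈ W), ν W * d W * (x W * y W))
    (HMM : 0 ≤ (∑ W ∈ U.powerset.filter (fun W => ∃ r ∈ ({m} : Finset V), r ∈ W), ν W * d W * (x W * y W)) * (((∑ W ∈ U.powerset.filter (fun W => ¬ ∃ r ∈ ({m} : Finset V) ∪ ent', r ∈ W), ν W * c W) * ((∑ W ∈ U.powerset.filter (fun W => ¬ ∃ r ∈ ({m} : Finset V) ∪ ent', r ∈ W), ν W * c W) + (∑ W ∈ U.powerset.filter (fun W => (¬ ∃ r ∈ ({m} : Finset V), r ∈ W) ∧ ∃ r ∈ ent', r ∈ W), ν W * (c W - d W)) + (∑ W ∈ U.powerset.filter (fun W => (¬ ∃ r ∈ ({m} : Finset V), r ∈ W) ∧ ∃ r ∈ ent', r ∈ W), ν W * d W) + (∑ W ∈ U.powerset.filter (fun W => ∃ r ∈ ({m} : Finset V), r ∈ W), ν W * d W)) * ((∑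 W ∈ U.powerset.filter (fun W => (¬ ∃ r ∈ ({m} : Finset V), r ∈ W) ∧ ∃ r ∈ ent', r ∈ W), ν W * (c W - d W) * x W) + (∑ W ∈ U.powerset.filter (fun W => (¬ ∃ r ∈ ({m} : Finset V), r ∈ W) ∧ ∃ r ∈ ent', r ∈ W), ν W * d W * x W) + (∑ W ∈ U.powerset.filter (fun W => ∃ r ∈ ({m} : Finset V), r ∈ W), ν W * d W * x W)) * ((∑ W ∈ U.powerset.filter (fun W => (¬ ∃ r ∈ ({m} : Finset V), r ∈ W) ∧ ∃ r ∈ ent', r ∈ W), ν W * (c W - d W) * y W) + (∑ W ∈ U.powerset.filter (fun W => (¬ ∃ r ∈ ({m} : Finset V), r ∈ W) ∧ ∃ r ∈ ent', r ∈ W), ν W * d W * y W) + (∑ W ∈ U.powerset.filter (fun W => ∃ r ∈ ({m} : Finset V), r ∈ W), ν W * d W * y W)) - ((∑ W ∈ U.powerset.filter (fun W => (¬ ∃ r ∈ ({m} : Finset V), r ∈ W) ∧ ∃ r ∈ ent', r ∈ W), ν W * (c W - d W) * x W) * ((∑ W ∈ U.powerset.filter (fun W => ¬ ∃ r ∈ ({m}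 : Finset V) ∪ ent', r ∈ W), ν W * c W) + (∑ W ∈ U.powerset.filter (fun W => (¬ ∃ r ∈ ({m} : Finset V), r ∈ W) ∧ ∃ r ∈ ent', r ∈ W), ν W * (c W - d W)) + (∑ W ∈ U.powerset.filter (fun W => (¬ ∃ r ∈ ({m} : Finset V), r ∈ W) ∧ ∃ r ∈ ent', r ∈ W), ν W * d W) + (∑ W ∈ U.powerset.filter (fun W => ∃ r ∈ ({m} : Finset V), r ∈ W), ν W * d W)) - (∑ W ∈ U.powerset.filter (fun W => (¬ ∃ r ∈ ({m} : Finset V), r ∈ W) ∧ ∃ r ∈ ent', r ∈ W), ν W * (c W - d W)) * ((∑ W ∈ U.powerset.filter (fun W => (¬ ∃ r ∈ ({m} : Finset V), r ∈ W) ∧ ∃ r ∈ ent', r ∈ W), ν W * (c W - d W) * x W) + (∑ W ∈ U.powerset.filter (fun W => (¬ ∃ r ∈ ({m} : Finset V), r ∈ W) ∧ ∃ r ∈ ent', r ∈ W), ν W * d W * x W) + (∑ W ∈ U.powerset.filter (fun W => ∃ r ∈ ({m} : Finset V), r ∈ W), ν W * d W * x W))) * ((∑ W ∈ U.powerset.filter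 (fun W => ∃ r ∈ ({m} : Finset V), r ∈ W), ν W * d W * y W) * ((∑ W ∈ U.powerset.filter (fun W => ¬ ∃ r ∈ ({m} : Finset V) ∪ ent', r ∈ W), ν W * c W) + (∑ W ∈ U.powerset.filter (fun W => (¬ ∃ r ∈ ({m} : Finset V), r ∈ W) ∧ ∃ r ∈ ent', r ∈ W), ν W * (c W - d W)) + (∑ W ∈ U.powerset.filter (fun W => (¬ ∃ r ∈ ({m} : Finset V), r ∈ W) ∧ ∃ r ∈ ent', r ∈ W), ν W * d W) + (∑ W ∈ U.powerset.filter (fun W => ∃ r ∈ ({m} : Finset V), r ∈ W), ν W * d W)) - (∑ W ∈ U.powerset.filter (fun W => ∃ r ∈ ({m} : Finset V), r ∈ W), ν W * d W) * ((∑ W ∈ U.powerset.filter (fun W => (¬ ∃ r ∈ ({m} : Finset V), r ∈ W) ∧ ∃ r ∈ ent', r ∈ W), ν W * (c W - d W) * y W) + (∑ W ∈ U.powerset.filter (fun W => (¬ ∃ r ∈ ({m} : Finset V), r ∈ W) ∧ ∃ r ∈ ent', r ∈ W), ν W * d W * y W) + (∑ W ∈ U.powerset.filter (fun W => ∃ r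 ∈ ({m} : Finset V), r ∈ W), ν W * d W * y W))) - ((∑ W ∈ U.powerset.filter (fun W => (¬ ∃ r ∈ ({m} : Finset V), r ∈ W) ∧ ∃ r ∈ ent', r ∈ W), ν W * (c W - d W) * y W) * ((∑ W ∈ U.powerset.filter (fun W => ¬ ∃ r ∈ ({m} : Finset V) ∪ ent', r ∈ W), ν W * c W) + (∑ W ∈ U.powerset.filter (fun W => (¬ ∃ r ∈ ({m} : Finset V), r ∈ W) ∧ ∃ r ∈ ent', r ∈ W), ν W * (c W - d W)) + (∑ W ∈ U.powerset.filter (fun W => (¬ ∃ r ∈ ({m} : Finset V), r ∈ W) ∧ ∃ r ∈ ent', r ∈ W), ν W * d W) + (∑ W ∈ U.powerset.filter (fun W => ∃ r ∈ ({m} : Finset V), r ∈ W), ν W * d W)) - (∑ W ∈ U.powerset.filter (fun W => (¬ ∃ r ∈ ({m} : Finset V), r ∈ W) ∧ ∃ r ∈ ent', r ∈ W), ν W * (c W - d W)) * ((∑ W ∈ U.powerset.filter (fun W => (¬ ∃ r ∈ ({m} : Finset V), r ∈ W) ∧ ∃ r ∈ ent', r ∈ W), ν W * (c W - d W) * y W)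 + (∑ W ∈ U.powerset.filter (fun W => (¬ ∃ r ∈ ({m} : Finset V), r ∈ W) ∧ ∃ r ∈ ent', r ∈ W), ν W * d W * y W) + (∑ W ∈ U.powerset.filter (fun W => ∃ r ∈ ({m} : Finset V), r ∈ W), ν W * d W * y W))) * ((∑ W ∈ U.powerset.filter (fun W => ∃ r ∈ ({m} : Finset V), r ∈ W), ν W * d W * x W) * ((∑ W ∈ U.powerset.filter (fun W => ¬ ∃ r ∈ ({m} : Finset V) ∪ ent', r ∈ W), ν W * c W) + (∑ W ∈ U.powerset.filter (fun W => (¬ ∃ r ∈ ({m} : Finset V), r ∈ W) ∧ ∃ r ∈ ent', r ∈ W), ν W * (c W - d W)) + (∑ W ∈ U.powerset.filter (fun W => (¬ ∃ r ∈ ({m} : Finset V), r ∈ W) ∧ ∃ r ∈ ent', r ∈ W), ν W * d W) + (∑ W ∈ U.powerset.filter (fun W => ∃ r ∈ ({m} : Finset V), r ∈ W), ν W * d W)) - (∑ W ∈ U.powerset.filter (fun W => ∃ r ∈ ({m} : Finset V), r ∈ W), ν W * d W) * ((∑ W ∈ U.powerset.filter (fun W => (¬ ∃ r ∈ ({m}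 : Finset V), r ∈ W) ∧ ∃ r ∈ ent', r ∈ W), ν W * (c W - d W) * x W) + (∑ W ∈ U.powerset.filter (fun W => (¬ ∃ r ∈ ({m} : Finset V), r ∈ W) ∧ ∃ r ∈ ent', r ∈ W), ν W * d W * x W) + (∑ W ∈ U.powerset.filter (fun W => ∃ r ∈ ({m} : Finset V), r ∈ W), ν W * d W * x W)))) + (((∑ W ∈ U.powerset.filter (fun W => ¬ ∃ r ∈ ({m} : Finset V) ∪ ent', r ∈ W), ν W * c W) + (∑ W ∈ U.powerset.filter (fun W => (¬ ∃ r ∈ ({m} : Finset V), r ∈ W) ∧ ∃ r ∈ ent', r ∈ W), ν W * (c W - d W)) + (∑ W ∈ U.powerset.filter (fun W => (¬ ∃ r ∈ ({m} : Finset V), r ∈ W) ∧ ∃ r ∈ ent', r ∈ W), ν W * d W) + (∑ W ∈ U.powerset.filter (fun W => ∃ r ∈ ({m} : Finset V), r ∈ W), ν W * d W)) * (((∑ W ∈ U.powerset.filter (fun W => ¬ ∃ r ∈ ({m} : Finset V) ∪ ent', r ∈ W), ν W * c W) + (∑ W ∈ U.powerset.filter (fun W => (¬ ∃ r ∈ ({m}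 : Finset V), r ∈ W) ∧ ∃ r ∈ ent', r ∈ W), ν W * (c W - d W)) + (∑ W ∈ U.powerset.filter (fun W => (¬ ∃ r ∈ ({m} : Finset V), r ∈ W) ∧ ∃ r ∈ ent', r ∈ W), ν W * d W) + (∑ W ∈ U.powerset.filter (fun W => ∃ r ∈ ({m} : Finset V), r ∈ W), ν W * d W)) - ((∑ W ∈ U.powerset.filter (fun W => (¬ ∃ r ∈ ({m} : Finset V), r ∈ W) ∧ ∃ r ∈ ent', r ∈ W), ν W * (c W - d W) * x W) + (∑ W ∈ U.powerset.filter (fun W => (¬ ∃ r ∈ ({m} : Finset V), r ∈ W) ∧ ∃ r ∈ ent', r ∈ W), ν W * d W * x W) + (∑ W ∈ U.powerset.filter (fun W => ∃ r ∈ ({m} : Finset V), r ∈ W), ν W * d W * x W))) * (((∑ W ∈ U.powerset.filter (fun W => ¬ ∃ r ∈ ({m} : Finset V) ∪ ent', r ∈ W), ν W * c W) + (∑ W ∈ U.powerset.filter (fun W => (¬ ∃ r ∈ ({m} : Finset V), r ∈ W) ∧ ∃ r ∈ ent', r ∈ W), ν W * (c W - d W)) + (∑ W ∈ U.powerset.filter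 (fun W => (¬ ∃ r ∈ ({m} : Finset V), r ∈ W) ∧ ∃ r ∈ ent', r ∈ W), ν W * d W) + (∑ W ∈ U.powerset.filter (fun W => ∃ r ∈ ({m} : Finset V), r ∈ W), ν W * d W)) - ((∑ W ∈ U.powerset.filter (fun W => (¬ ∃ r ∈ ({m} : Finset V), r ∈ W) ∧ ∃ r ∈ ent', r ∈ W), ν W * (c W - d W) * y W) + (∑ W ∈ U.powerset.filter (fun W => (¬ ∃ r ∈ ({m} : Finset V), r ∈ W) ∧ ∃ r ∈ ent', r ∈ W), ν W * d W * y W) + (∑ W ∈ U.powerset.filter (fun W => ∃ r ∈ ({m} : Finset V), r ∈ W), ν W * d W * y W))) + ((∑ W ∈ U.powerset.filter (fun W => (¬ ∃ r ∈ ({m} : Finset V), r ∈ W) ∧ ∃ r ∈ ent', r ∈ W), ν W * (c W - d W) * x W) * ((∑ W ∈ U.powerset.filter (fun W => ¬ ∃ r ∈ ({m} : Finset V) ∪ ent', r ∈ W), ν W * c W) + (∑ W ∈ U.powerset.filter (fun W => (¬ ∃ r ∈ ({m} : Finset V), r ∈ W) ∧ ∃ r ∈ ent', r ∈ W), ν W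 * (c W - d W)) + (∑ W ∈ U.powerset.filter (fun W => (¬ ∃ r ∈ ({m} : Finset V), r ∈ W) ∧ ∃ r ∈ ent', r ∈ W), ν W * d W) + (∑ W ∈ U.powerset.filter (fun W => ∃ r ∈ ({m} : Finset V), r ∈ W), ν W * d W)) - (∑ W ∈ U.powerset.filter (fun W => (¬ ∃ r ∈ ({m} : Finset V), r ∈ W) ∧ ∃ r ∈ ent', r ∈ W), ν W * (c W - d W)) * ((∑ W ∈ U.powerset.filter (fun W => (¬ ∃ r ∈ ({m} : Finset V), r ∈ W) ∧ ∃ r ∈ ent', r ∈ W), ν W * (c W - d W) * x W) + (∑ W ∈ U.powerset.filter (fun W => (¬ ∃ r ∈ ({m} : Finset V), r ∈ W) ∧ ∃ r ∈ ent', r ∈ W), ν W * d W * x W) + (∑ W ∈ U.powerset.filter (fun W => ∃ r ∈ ({m} : Finset V), r ∈ W), ν W * d W * x W))) * (((∑ W ∈ U.powerset.filter (fun W => ¬ ∃ r ∈ ({m} : Finset V) ∪ ent', r ∈ W), ν W * c W) + (∑ W ∈ U.powerset.filter (fun W => (¬ ∃ r ∈ ({m} : Finset V), r ∈ W) ∧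 ∃ r ∈ ent', r ∈ W), ν W * (c W - d W)) + (∑ W ∈ U.powerset.filter (fun W => (¬ ∃ r ∈ ({m} : Finset V), r ∈ W) ∧ ∃ r ∈ ent', r ∈ W), ν W * d W) + (∑ W ∈ U.powerset.filter (fun W => ∃ r ∈ ({m} : Finset V), r ∈ W), ν W * d W)) - ((∑ W ∈ U.powerset.filter (fun W => (¬ ∃ r ∈ ({m} : Finset V), r ∈ W) ∧ ∃ r ∈ ent', r ∈ W), ν W * (c W - d W) * y W) + (∑ W ∈ U.powerset.filter (fun W => (¬ ∃ r ∈ ({m} : Finset V), r ∈ W) ∧ ∃ r ∈ ent', r ∈ W), ν W * d W * y W) + (∑ W ∈ U.powerset.filter (fun W => ∃ r ∈ ({m} : Finset V), r ∈ W), ν W * d W * y W))) + ((∑ W ∈ U.powerset.filter (fun W => (¬ ∃ r ∈ ({m} : Finset V), r ∈ W) ∧ ∃ r ∈ ent', r ∈ W), ν W * (c W - d W) * y W) * ((∑ W ∈ U.powerset.filter (fun W => ¬ ∃ r ∈ ({m} : Finset V) ∪ ent', r ∈ W), ν W * c W) + (∑ W ∈ U.powerset.filter (fun W => (¬ ∃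 r ∈ ({m} : Finset V), r ∈ W) ∧ ∃ r ∈ ent', r ∈ W), ν W * (c W - d W)) + (∑ W ∈ U.powerset.filter (fun W => (¬ ∃ r ∈ ({m} : Finset V), r ∈ W) ∧ ∃ r ∈ ent', r ∈ W), ν W * d W) + (∑ W ∈ U.powerset.filter (fun W => ∃ r ∈ ({m} : Finset V), r ∈ W), ν W * d W)) - (∑ W ∈ U.powerset.filter (fun W => (¬ ∃ r ∈ ({m} : Finset V), r ∈ W) ∧ ∃ r ∈ ent', r ∈ W), ν W * (c W - d W)) * ((∑ W ∈ U.powerset.filter (fun W => (¬ ∃ r ∈ ({m} : Finset V), r ∈ W) ∧ ∃ r ∈ ent', r ∈ W), ν W * (c W - d W) * y W) + (∑ W ∈ U.powerset.filter (fun W => (¬ ∃ r ∈ ({m} : Finset V), r ∈ W) ∧ ∃ r ∈ ent', r ∈ W), ν W * d W * y W) + (∑ W ∈ U.powerset.filter (fun W => ∃ r ∈ ({m} : Finset V), r ∈ W), ν W * d W * y W))) * (((∑ W ∈ U.powerset.filter (fun W => ¬ ∃ r ∈ ({m} : Finset V) ∪ ent', r ∈ W), ν W * c W) + (∑ W ∈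 U.powerset.filter (fun W => (¬ ∃ r ∈ ({m} : Finset V), r ∈ W) ∧ ∃ r ∈ ent', r ∈ W), ν W * (c W - d W)) + (∑ W ∈ U.powerset.filter (fun W => (¬ ∃ r ∈ ({m} : Finset V), r ∈ W) ∧ ∃ r ∈ ent', r ∈ W), ν W * d W) + (∑ W ∈ U.powerset.filter (fun W => ∃ r ∈ ({m} : Finset V), r ∈ W), ν W * d W)) - ((∑ W ∈ U.powerset.filter (fun W => (¬ ∃ r ∈ ({m} : Finset V), r ∈ W) ∧ ∃ r ∈ ent', r ∈ W), ν W * (c W - d W) * x W) + (∑ W ∈ U.powerset.filter (fun W => (¬ ∃ r ∈ ({m} : Finset V), r ∈ W) ∧ ∃ r ∈ ent', r ∈ W), ν W * d W * x W) + (∑ W ∈ U.powerset.filter (fun W => ∃ r ∈ ({m} : Finset V), r ∈ W), ν W * d W * x W)))) * (∑ W ∈ U.powerset.filter (fun W => ∃ r ∈ ({m} : Finset V), r ∈ W), ν W * d W * (x W * y W)) + (-((((∑ W ∈ U.powerset.filter (fun W => ¬ ∃ r ∈ ({m} : Finset V) ∪ ent', r ∈ W), ν W * c W) + (∑ W ∈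 U.powerset.filter (fun W => (¬ ∃ r ∈ ({m} : Finset V), r ∈ W) ∧ ∃ r ∈ ent', r ∈ W), ν W * (c W - d W)) + (∑ W ∈ U.powerset.filter (fun W => (¬ ∃ r ∈ ({m} : Finset V), r ∈ W) ∧ ∃ r ∈ ent', r ∈ W), ν W * d W) + (∑ W ∈ U.powerset.filter (fun W => ∃ r ∈ ({m} : Finset V), r ∈ W), ν W * d W)) * ((∑ W ∈ U.powerset.filter (fun W => ¬ ∃ r ∈ ({m} : Finset V) ∪ ent', r ∈ W), ν W * c W) + (∑ W ∈ U.powerset.filter (fun W => (¬ ∃ r ∈ ({m} : Finset V), r ∈ W) ∧ ∃ r ∈ ent', r ∈ W), ν W * (c W - d W)) + (∑ W ∈ U.powerset.filter (fun W => (¬ ∃ r ∈ ({m} : Finset V), r ∈ W) ∧ ∃ r ∈ ent', r ∈ W), ν W * d W) + (∑ W ∈ U.powerset.filter (fun W => ∃ r ∈ ({m} : Finset V), r ∈ W), ν W * d W)) * ((∑ W ∈ U.powerset.filter (fun W => (¬ ∃ r ∈ ({m} : Finset V), r ∈ W) ∧ ∃ r ∈ ent', r ∈ W), ν W * (c W -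 d W) * y W) + (∑ W ∈ U.powerset.filter (fun W => (¬ ∃ r ∈ ({m} : Finset V), r ∈ W) ∧ ∃ r ∈ ent', r ∈ W), ν W * d W * y W) + (∑ W ∈ U.powerset.filter (fun W => ∃ r ∈ ({m} : Finset V), r ∈ W), ν W * d W * y W)) + ((∑ W ∈ U.powerset.filter (fun W => ¬ ∃ r ∈ ({m} : Finset V) ∪ ent', r ∈ W), ν W * c W) + (∑ W ∈ U.powerset.filter (fun W => (¬ ∃ r ∈ ({m} : Finset V), r ∈ W) ∧ ∃ r ∈ ent', r ∈ W), ν W * (c W - d W)) + (∑ W ∈ U.powerset.filter (fun W => (¬ ∃ r ∈ ({m} : Finset V), r ∈ W) ∧ ∃ r ∈ ent', r ∈ W), ν W * d W) + (∑ W ∈ U.powerset.filter (fun W => ∃ r ∈ ({m} : Finset V), r ∈ W), ν W * d W)) * (((∑ W ∈ U.powerset.filter (fun W => ¬ ∃ r ∈ ({m} : Finset V) ∪ ent', r ∈ W), ν W * c W) + (∑ W ∈ U.powerset.filter (fun W => (¬ ∃ r ∈ ({m} : Finset V), r ∈ W) ∧ ∃ r ∈ ent', r ∈ W), ν W * (c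 W - d W)) + (∑ W ∈ U.powerset.filter (fun W => (¬ ∃ r ∈ ({m} : Finset V), r ∈ W) ∧ ∃ r ∈ ent', r ∈ W), ν W * d W) + (∑ W ∈ U.powerset.filter (fun W => ∃ r ∈ ({m} : Finset V), r ∈ W), ν W * d W)) * ((∑ W ∈ U.powerset.filter (fun W => (¬ ∃ r ∈ ({m} : Finset V), r ∈ W) ∧ ∃ r ∈ ent', r ∈ W), ν W * d W * y W) + (∑ W ∈ U.powerset.filter (fun W => ∃ r ∈ ({m} : Finset V), r ∈ W), ν W * d W * y W)) - ((∑ W ∈ U.powerset.filter (fun W => (¬ ∃ r ∈ ({m} : Finset V), r ∈ W) ∧ ∃ r ∈ ent', r ∈ W), ν W * (c W - d W) * y W) + (∑ W ∈ U.powerset.filter (fun W => (¬ ∃ r ∈ ({m} : Finset V), r ∈ W) ∧ ∃ r ∈ ent', r ∈ W), ν W * d W * y W) + (∑ W ∈ U.powerset.filter (fun W => ∃ r ∈ ({m} : Finset V), r ∈ W), ν W * d W * y W)) * ((∑ W ∈ U.powerset.filter (fun W => ¬ ∃ r ∈ ({m} : Finset V) ∪ ent', r ∈ W), ν W * c W)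 + (∑ W ∈ U.powerset.filter (fun W => (¬ ∃ r ∈ ({m} : Finset V), r ∈ W) ∧ ∃ r ∈ ent', r ∈ W), ν W * d W) + (∑ W ∈ U.powerset.filter (fun W => ∃ r ∈ ({m} : Finset V), r ∈ W), ν W * d W)))) - (((∑ W ∈ U.powerset.filter (fun W => ¬ ∃ r ∈ ({m} : Finset V) ∪ ent', r ∈ W), ν W * c W) + (∑ W ∈ U.powerset.filter (fun W => (¬ ∃ r ∈ ({m} : Finset V), r ∈ W) ∧ ∃ r ∈ ent', r ∈ W), ν W * (c W - d W)) + (∑ W ∈ U.powerset.filter (fun W => (¬ ∃ r ∈ ({m} : Finset V), r ∈ W) ∧ ∃ r ∈ ent', r ∈ W), ν W * d W) + (∑ W ∈ U.powerset.filter (fun W => ∃ r ∈ ({m} : Finset V), r ∈ W), ν W * d W)) * ((∑ W ∈ U.powerset.filter (fun W => (¬ ∃ r ∈ ({m} : Finset V), r ∈ W) ∧ ∃ r ∈ ent', r ∈ W), ν W * (c W - d W) * x W) + (∑ W ∈ U.powerset.filter (fun W => (¬ ∃ r ∈ ({m} : Finset V), r ∈ W) ∧ ∃ r ∈ ent', r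 ∈ W), ν W * d W * x W) + (∑ W ∈ U.powerset.filter (fun W => ∃ r ∈ ({m} : Finset V), r ∈ W), ν W * d W * x W)) * ((∑ W ∈ U.powerset.filter (fun W => (¬ ∃ r ∈ ({m} : Finset V), r ∈ W) ∧ ∃ r ∈ ent', r ∈ W), ν W * (c W - d W) * y W) + (∑ W ∈ U.powerset.filter (fun W => (¬ ∃ r ∈ ({m} : Finset V), r ∈ W) ∧ ∃ r ∈ ent', r ∈ W), ν W * d W * y W) + (∑ W ∈ U.powerset.filter (fun W => ∃ r ∈ ({m} : Finset V), r ∈ W), ν W * d W * y W)) + (((∑ W ∈ U.powerset.filter (fun W => ¬ ∃ r ∈ ({m} : Finset V) ∪ ent', r ∈ W), ν W * c W) + (∑ W ∈ U.powerset.filter (fun W => (¬ ∃ r ∈ ({m} : Finset V), r ∈ W) ∧ ∃ r ∈ ent', r ∈ W), ν W * (c W - d W)) + (∑ W ∈ U.powerset.filter (fun W => (¬ ∃ r ∈ ({m} : Finset V), r ∈ W) ∧ ∃ r ∈ ent', r ∈ W), ν W * d W) + (∑ W ∈ U.powerset.filter (fun W => ∃ r ∈ ({m} : Finset V), r ∈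 W), ν W * d W)) * ((∑ W ∈ U.powerset.filter (fun W => (¬ ∃ r ∈ ({m} : Finset V), r ∈ W) ∧ ∃ r ∈ ent', r ∈ W), ν W * d W * x W) + (∑ W ∈ U.powerset.filter (fun W => ∃ r ∈ ({m} : Finset V), r ∈ W), ν W * d W * x W)) - ((∑ W ∈ U.powerset.filter (fun W => (¬ ∃ r ∈ ({m} : Finset V), r ∈ W) ∧ ∃ r ∈ ent', r ∈ W), ν W * (c W - d W) * x W) + (∑ W ∈ U.powerset.filter (fun W => (¬ ∃ r ∈ ({m} : Finset V), r ∈ W) ∧ ∃ r ∈ ent', r ∈ W), ν W * d W * x W) + (∑ W ∈ U.powerset.filter (fun W => ∃ r ∈ ({m} : Finset V), r ∈ W), ν W * d W * x W)) * ((∑ W ∈ U.powerset.filter (fun W => ¬ ∃ r ∈ ({m} : Finset V) ∪ ent', r ∈ W), ν W * c W) + (∑ W ∈ U.powerset.filter (fun W => (¬ ∃ r ∈ ({m} : Finset V), r ∈ W) ∧ ∃ r ∈ ent', r ∈ W), ν W * d W) + (∑ W ∈ U.powerset.filter (fun W => ∃ r ∈ ({m} : Finset V), r ∈ W), ν W *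 d W))) * ((∑ W ∈ U.powerset.filter (fun W => (¬ ∃ r ∈ ({m} : Finset V), r ∈ W) ∧ ∃ r ∈ ent', r ∈ W), ν W * (c W - d W) * y W) + (∑ W ∈ U.powerset.filter (fun W => (¬ ∃ r ∈ ({m} : Finset V), r ∈ W) ∧ ∃ r ∈ ent', r ∈ W), ν W * d W * y W) + (∑ W ∈ U.powerset.filter (fun W => ∃ r ∈ ({m} : Finset V), r ∈ W), ν W * d W * y W)) + (((∑ W ∈ U.powerset.filter (fun W => ¬ ∃ r ∈ ({m} : Finset V) ∪ ent', r ∈ W), ν W * c W) + (∑ W ∈ U.powerset.filter (fun W => (¬ ∃ r ∈ ({m} : Finset V), r ∈ W) ∧ ∃ r ∈ ent', r ∈ W), ν W * (c W - d W)) + (∑ W ∈ U.powerset.filter (fun W => (¬ ∃ r ∈ ({m} : Finset V), r ∈ W) ∧ ∃ r ∈ ent', r ∈ W), ν W * d W) + (∑ W ∈ U.powerset.filter (fun W => ∃ r ∈ ({m} : Finset V), r ∈ W), ν W * d W)) * ((∑ W ∈ U.powerset.filter (fun W => (¬ ∃ r ∈ ({m} : Finset V), r ∈ W) ∧ ∃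 r ∈ ent', r ∈ W), ν W * d W * y W) + (∑ W ∈ U.powerset.filter (fun W => ∃ r ∈ ({m} : Finset V), r ∈ W), ν W * d W * y W)) - ((∑ W ∈ U.powerset.filter (fun W => (¬ ∃ r ∈ ({m} : Finset V), r ∈ W) ∧ ∃ r ∈ ent', r ∈ W), ν W * (c W - d W) * y W) + (∑ W ∈ U.powerset.filter (fun W => (¬ ∃ r ∈ ({m} : Finset V), r ∈ W) ∧ ∃ r ∈ ent', r ∈ W), ν W * d W * y W) + (∑ W ∈ U.powerset.filter (fun W => ∃ r ∈ ({m} : Finset V), r ∈ W), ν W * d W * y W)) * ((∑ W ∈ U.powerset.filter (fun W => ¬ ∃ r ∈ ({m} : Finset V) ∪ ent', r ∈ W), ν W * c W) + (∑ W ∈ U.powerset.filter (fun W => (¬ ∃ r ∈ ({m} : Finset V), r ∈ W) ∧ ∃ r ∈ ent', r ∈ W), ν W * d W) + (∑ W ∈ U.powerset.filter (fun W => ∃ r ∈ ({m} : Finset V), r ∈ W), ν W * d W))) * ((∑ W ∈ U.powerset.filter (fun W => (¬ ∃ r ∈ ({m} : Finset V), r ∈ W) ∧ ∃ r ∈ ent',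 r ∈ W), ν W * (c W - d W) * x W) + (∑ W ∈ U.powerset.filter (fun W => (¬ ∃ r ∈ ({m} : Finset V), r ∈ W) ∧ ∃ r ∈ ent', r ∈ W), ν W * d W * x W) + (∑ W ∈ U.powerset.filter (fun W => ∃ r ∈ ({m} : Finset V), r ∈ W), ν W * d W * x W))))) * ((∑ W ∈ U.powerset.filter (fun W => ∃ r ∈ ({m} : Finset V), r ∈ W), ν W * d W * x W) - (∑ W ∈ U.powerset.filter (fun W => ∃ r ∈ ({m} : Finset V), r ∈ W), ν W * d W * (x W * y W))) + (-((((∑ W ∈ U.powerset.filter (fun W => ¬ ∃ r ∈ ({m} : Finset V) ∪ ent', r ∈ W), ν W * c W) + (∑ W ∈ U.powerset.filter (fun W => (¬ ∃ r ∈ ({m} : Finset V), r ∈ W) ∧ ∃ r ∈ ent', r ∈ W), ν W * (c W - d W)) + (∑ W ∈ U.powerset.filter (fun W => (¬ ∃ r ∈ ({m} : Finset V), r ∈ W) ∧ ∃ r ∈ ent', r ∈ W), ν W * d W) + (∑ W ∈ U.powerset.filter (fun W => ∃ r ∈ ({m} : Finset V), r ∈ W), ν W * d W)) * ((∑ W ∈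 U.powerset.filter (fun W => ¬ ∃ r ∈ ({m} : Finset V) ∪ ent', r ∈ W), ν W * c W) + (∑ W ∈ U.powerset.filter (fun W => (¬ ∃ r ∈ ({m} : Finset V), r ∈ W) ∧ ∃ r ∈ ent', r ∈ W), ν W * (c W - d W)) + (∑ W ∈ U.powerset.filter (fun W => (¬ ∃ r ∈ ({m} : Finset V), r ∈ W) ∧ ∃ r ∈ ent', r ∈ W), ν W * d W) + (∑ W ∈ U.powerset.filter (fun W => ∃ r ∈ ({m} : Finset V), r ∈ W), ν W * d W)) * ((∑ W ∈ U.powerset.filter (fun W => (¬ ∃ r ∈ ({m} : Finset V), r ∈ W) ∧ ∃ r ∈ ent', r ∈ W), ν W * (c W - d W) * x W) + (∑ W ∈ U.powerset.filter (fun W => (¬ ∃ r ∈ ({m} : Finset V), r ∈ W) ∧ ∃ r ∈ ent', r ∈ W), ν W * d W * x W) + (∑ W ∈ U.powerset.filter (fun W => ∃ r ∈ ({m} : Finset V), r ∈ W), ν W * d W * x W)) + ((∑ W ∈ U.powerset.filter (fun W => ¬ ∃ r ∈ ({m} : Finset V) ∪ ent', r ∈ W), ν W * c W) + (∑ W ∈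 U.powerset.filter (fun W => (¬ ∃ r ∈ ({m} : Finset V), r ∈ W) ∧ ∃ r ∈ ent', r ∈ W), ν W * (c W - d W)) + (∑ W ∈ U.powerset.filter (fun W => (¬ ∃ r ∈ ({m} : Finset V), r ∈ W) ∧ ∃ r ∈ ent', r ∈ W), ν W * d W) + (∑ W ∈ U.powerset.filter (fun W => ∃ r ∈ ({m} : Finset V), r ∈ W), ν W * d W)) * (((∑ W ∈ U.powerset.filter (fun W => ¬ ∃ r ∈ ({m} : Finset V) ∪ ent', r ∈ W), ν W * c W) + (∑ W ∈ U.powerset.filter (fun W => (¬ ∃ r ∈ ({m} : Finset V), r ∈ W) ∧ ∃ r ∈ ent', r ∈ W), ν W * (c W - d W)) + (∑ W ∈ U.powerset.filter (fun W => (¬ ∃ r ∈ ({m} : Finset V), r ∈ W) ∧ ∃ r ∈ ent', r ∈ W), ν W * d W) + (∑ W ∈ U.powerset.filter (fun W => ∃ r ∈ ({m} : Finset V), r ∈ W), ν W * d W)) * ((∑ W ∈ U.powerset.filter (fun W => (¬ ∃ r ∈ ({m} : Finset V), r ∈ W) ∧ ∃ r ∈ ent', r ∈ W), ν W * d W * x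 W) + (∑ W ∈ U.powerset.filter (fun W => ∃ r ∈ ({m} : Finset V), r ∈ W), ν W * d W * x W)) - ((∑ W ∈ U.powerset.filter (fun W => (¬ ∃ r ∈ ({m} : Finset V), r ∈ W) ∧ ∃ r ∈ ent', r ∈ W), ν W * (c W - d W) * x W) + (∑ W ∈ U.powerset.filter (fun W => (¬ ∃ r ∈ ({m} : Finset V), r ∈ W) ∧ ∃ r ∈ ent', r ∈ W), ν W * d W * x W) + (∑ W ∈ U.powerset.filter (fun W => ∃ r ∈ ({m} : Finset V), r ∈ W), ν W * d W * x W)) * ((∑ W ∈ U.powerset.filter (fun W => ¬ ∃ r ∈ ({m} : Finset V) ∪ ent', r ∈ W), ν W * c W) + (∑ W ∈ U.powerset.filter (fun W => (¬ ∃ r ∈ ({m} : Finset V), r ∈ W) ∧ ∃ r ∈ ent', r ∈ W), ν W * d W) + (∑ W ∈ U.powerset.filter (fun W => ∃ r ∈ ({m} : Finset V), r ∈ W), ν W * d W)))) - (((∑ W ∈ U.powerset.filter (fun W => ¬ ∃ r ∈ ({m} : Finset V) ∪ ent', r ∈ W), ν W * c W) + (∑ W ∈ U.powerset.filter (fun W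 => (¬ ∃ r ∈ ({m} : Finset V), r ∈ W) ∧ ∃ r ∈ ent', r ∈ W), ν W * (c W - d W)) + (∑ W ∈ U.powerset.filter (fun W => (¬ ∃ r ∈ ({m} : Finset V), r ∈ W) ∧ ∃ r ∈ ent', r ∈ W), ν W * d W) + (∑ W ∈ U.powerset.filter (fun W => ∃ r ∈ ({m} : Finset V), r ∈ W), ν W * d W)) * ((∑ W ∈ U.powerset.filter (fun W => (¬ ∃ r ∈ ({m} : Finset V), r ∈ W) ∧ ∃ r ∈ ent', r ∈ W), ν W * (c W - d W) * x W) + (∑ W ∈ U.powerset.filter (fun W => (¬ ∃ r ∈ ({m} : Finset V), r ∈ W) ∧ ∃ r ∈ ent', r ∈ W), ν W * d W * x W) + (∑ W ∈ U.powerset.filter (fun W => ∃ r ∈ ({m} : Finset V), r ∈ W), ν W * d W * x W)) * ((∑ W ∈ U.powerset.filter (fun W => (¬ ∃ r ∈ ({m} : Finset V), r ∈ W) ∧ ∃ r ∈ ent', r ∈ W), ν W * (c W - d W) * y W) + (∑ W ∈ U.powerset.filter (fun W => (¬ ∃ r ∈ ({m} : Finset V), r ∈ W) ∧ ∃ r ∈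 ent', r ∈ W), ν W * d W * y W) + (∑ W ∈ U.powerset.filter (fun W => ∃ r ∈ ({m} : Finset V), r ∈ W), ν W * d W * y W)) + (((∑ W ∈ U.powerset.filter (fun W => ¬ ∃ r ∈ ({m} : Finset V) ∪ ent', r ∈ W), ν W * c W) + (∑ W ∈ U.powerset.filter (fun W => (¬ ∃ r ∈ ({m} : Finset V), r ∈ W) ∧ ∃ r ∈ ent', r ∈ W), ν W * (c W - d W)) + (∑ W ∈ U.powerset.filter (fun W => (¬ ∃ r ∈ ({m} : Finset V), r ∈ W) ∧ ∃ r ∈ ent', r ∈ W), ν W * d W) + (∑ W ∈ U.powerset.filter (fun W => ∃ r ∈ ({m} : Finset V), r ∈ W), ν W * d W)) * ((∑ W ∈ U.powerset.filter (fun W => (¬ ∃ r ∈ ({m} : Finset V), r ∈ W) ∧ ∃ r ∈ ent', r ∈ W), ν W * d W * x W) + (∑ W ∈ U.powerset.filter (fun W => ∃ r ∈ ({m} : Finset V), r ∈ W), ν W * d W * x W)) - ((∑ W ∈ U.powerset.filter (fun W => (¬ ∃ r ∈ ({m} : Finset V), r ∈ W) ∧ ∃ r ∈ ent', r ∈ W),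 ν W * (c W - d W) * x W) + (∑ W ∈ U.powerset.filter (fun W => (¬ ∃ r ∈ ({m} : Finset V), r ∈ W) ∧ ∃ r ∈ ent', r ∈ W), ν W * d W * x W) + (∑ W ∈ U.powerset.filter (fun W => ∃ r ∈ ({m} : Finset V), r ∈ W), ν W * d W * x W)) * ((∑ W ∈ U.powerset.filter (fun W => ¬ ∃ r ∈ ({m} : Finset V) ∪ ent', r ∈ W), ν W * c W) + (∑ W ∈ U.powerset.filter (fun W => (¬ ∃ r ∈ ({m} : Finset V), r ∈ W) ∧ ∃ r ∈ ent', r ∈ W), ν W * d W) + (∑ W ∈ U.powerset.filter (fun W => ∃ r ∈ ({m} : Finset V), r ∈ W), ν W * d W))) * ((∑ W ∈ U.powerset.filter (fun W => (¬ ∃ r ∈ ({m} : Finset V), r ∈ W) ∧ ∃ r ∈ ent', r ∈ W), ν W * (c W - d W) * y W) + (∑ W ∈ U.powerset.filter (fun W => (¬ ∃ r ∈ ({m} : Finset V), r ∈ W) ∧ ∃ r ∈ ent', r ∈ W), ν W * d W * y W) + (∑ W ∈ U.powerset.filter (fun W => ∃ r ∈ ({m} : Finset V), r ∈ W), ν W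 * d W * y W)) + (((∑ W ∈ U.powerset.filter (fun W => ¬ ∃ r ∈ ({m} : Finset V) ∪ ent', r ∈ W), ν W * c W) + (∑ W ∈ U.powerset.filter (fun W => (¬ ∃ r ∈ ({m} : Finset V), r ∈ W) ∧ ∃ r ∈ ent', r ∈ W), ν W * (c W - d W)) + (∑ W ∈ U.powerset.filter (fun W => (¬ ∃ r ∈ ({m} : Finset V), r ∈ W) ∧ ∃ r ∈ ent', r ∈ W), ν W * d W) + (∑ W ∈ U.powerset.filter (fun W => ∃ r ∈ ({m} : Finset V), r ∈ W), ν W * d W)) * ((∑ W ∈ U.powerset.filter (fun W => (¬ ∃ r ∈ ({m} : Finset V), r ∈ W) ∧ ∃ r ∈ ent', r ∈ W), ν W * d W * y W) + (∑ W ∈ U.powerset.filter (fun W => ∃ r ∈ ({m} : Finset V), r ∈ W), ν W * d W * y W)) - ((∑ W ∈ U.powerset.filter (fun W => (¬ ∃ r ∈ ({m} : Finset V), r ∈ W) ∧ ∃ r ∈ ent', r ∈ W), ν W * (c W - d W) * y W) + (∑ W ∈ U.powerset.filter (fun W => (¬ ∃ r ∈ ({m} : Finset V), r ∈ W) ∧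 ∃ r ∈ ent', r ∈ W), ν W * d W * y W) + (∑ W ∈ U.powerset.filter (fun W => ∃ r ∈ ({m} : Finset V), r ∈ W), ν W * d W * y W)) * ((∑ W ∈ U.powerset.filter (fun W => ¬ ∃ r ∈ ({m} : Finset V) ∪ ent', r ∈ W), ν W * c W) + (∑ W ∈ U.powerset.filter (fun W => (¬ ∃ r ∈ ({m} : Finset V), r ∈ W) ∧ ∃ r ∈ ent', r ∈ W), ν W * d W) + (∑ W ∈ U.powerset.filter (fun W => ∃ r ∈ ({m} : Finset V), r ∈ W), ν W * d W))) * ((∑ W ∈ U.powerset.filter (fun W => (¬ ∃ r ∈ ({m} : Finset V), r ∈ W) ∧ ∃ r ∈ ent', r ∈ W), ν W * (c W - d W) * x W) + (∑ W ∈ U.powerset.filter (fun W => (¬ ∃ r ∈ ({m} : Finset V), r ∈ W) ∧ ∃ r ∈ ent', r ∈ W), ν W * d W * x W) + (∑ W ∈ U.powerset.filter (fun W => ∃ r ∈ ({m} : Finset V), r ∈ W), ν W * d W * x W))))) * ((∑ W ∈ U.powerset.filter (fun W => ∃ r ∈ ({m} : Finset V), r ∈ W), ν W * d W * y W) - (∑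 W ∈ U.powerset.filter (fun W => ∃ r ∈ ({m} : Finset V), r ∈ W), ν W * d W * (x W * y W)))) + (((∑ W ∈ U.powerset.filter (fun W => ¬ ∃ r ∈ ({m} : Finset V) ∪ ent', r ∈ W), ν W * c W) + (∑ W ∈ U.powerset.filter (fun W => (¬ ∃ r ∈ ({m} : Finset V), r ∈ W) ∧ ∃ r ∈ ent', r ∈ W), ν W * (c W - d W)) + (∑ W ∈ U.powerset.filter (fun W => (¬ ∃ r ∈ ({m} : Finset V), r ∈ W) ∧ ∃ r ∈ ent', r ∈ W), ν W * d W) + (∑ W ∈ U.powerset.filter (fun W => ∃ r ∈ ({m} : Finset V), r ∈ W), ν W * d W)) * ((∑ W ∈ U.powerset.filter (fun W => (¬ ∃ r ∈ ({m} : Finset V), r ∈ W) ∧ ∃ r ∈ ent', r ∈ W), ν W * (c W - d W) * x W) + (∑ W ∈ U.powerset.filter (fun W => (¬ ∃ r ∈ ({m} : Finset V), r ∈ W) ∧ ∃ r ∈ ent', r ∈ W), ν W * d W * x W) + (∑ W ∈ U.powerset.filter (fun W => ∃ r ∈ ({m} : Finset V), r ∈ W), ν W * d W * x W)) * ((∑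 W ∈ U.powerset.filter (fun W => (¬ ∃ r ∈ ({m} : Finset V), r ∈ W) ∧ ∃ r ∈ ent', r ∈ W), ν W * (c W - d W) * y W) + (∑ W ∈ U.powerset.filter (fun W => (¬ ∃ r ∈ ({m} : Finset V), r ∈ W) ∧ ∃ r ∈ ent', r ∈ W), ν W * d W * y W) + (∑ W ∈ U.powerset.filter (fun W => ∃ r ∈ ({m} : Finset V), r ∈ W), ν W * d W * y W)) + (((∑ W ∈ U.powerset.filter (fun W => ¬ ∃ r ∈ ({m} : Finset V) ∪ ent', r ∈ W), ν W * c W) + (∑ W ∈ U.powerset.filter (fun W => (¬ ∃ r ∈ ({m} : Finset V), r ∈ W) ∧ ∃ r ∈ ent', r ∈ W), ν W * (c W - d W)) + (∑ W ∈ U.powerset.filter (fun W => (¬ ∃ r ∈ ({m} : Finset V), r ∈ W) ∧ ∃ r ∈ ent', r ∈ W), ν W * d W) + (∑ W ∈ U.powerset.filter (fun W => ∃ r ∈ ({m} : Finset V), r ∈ W), ν W * d W)) * ((∑ W ∈ U.powerset.filter (fun W => (¬ ∃ r ∈ ({m} : Finset V), r ∈ W) ∧ ∃ r ∈ ent', r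 ∈ W), ν W * d W * x W) + (∑ W ∈ U.powerset.filter (fun W => ∃ r ∈ ({m} : Finset V), r ∈ W), ν W * d W * x W)) - ((∑ W ∈ U.powerset.filter (fun W => (¬ ∃ r ∈ ({m} : Finset V), r ∈ W) ∧ ∃ r ∈ ent', r ∈ W), ν W * (c W - d W) * x W) + (∑ W ∈ U.powerset.filter (fun W => (¬ ∃ r ∈ ({m} : Finset V), r ∈ W) ∧ ∃ r ∈ ent', r ∈ W), ν W * d W * x W) + (∑ W ∈ U.powerset.filter (fun W => ∃ r ∈ ({m} : Finset V), r ∈ W), ν W * d W * x W)) * ((∑ W ∈ U.powerset.filter (fun W => ¬ ∃ r ∈ ({m} : Finset V) ∪ ent', r ∈ W), ν W * c W) + (∑ W ∈ U.powerset.filter (fun W => (¬ ∃ r ∈ ({m} : Finset V), r ∈ W) ∧ ∃ r ∈ ent', r ∈ W), ν W * d W) + (∑ W ∈ U.powerset.filter (fun W => ∃ r ∈ ({m} : Finset V), r ∈ W), ν W * d W))) * ((∑ W ∈ U.powerset.filter (fun W => (¬ ∃ r ∈ ({m} : Finset V), r ∈ W) ∧ ∃ r ∈ ent', r ∈ W),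 ν W * (c W - d W) * y W) + (∑ W ∈ U.powerset.filter (fun W => (¬ ∃ r ∈ ({m} : Finset V), r ∈ W) ∧ ∃ r ∈ ent', r ∈ W), ν W * d W * y W) + (∑ W ∈ U.powerset.filter (fun W => ∃ r ∈ ({m} : Finset V), r ∈ W), ν W * d W * y W)) + (((∑ W ∈ U.powerset.filter (fun W => ¬ ∃ r ∈ ({m} : Finset V) ∪ ent', r ∈ W), ν W * c W) + (∑ W ∈ U.powerset.filter (fun W => (¬ ∃ r ∈ ({m} : Finset V), r ∈ W) ∧ ∃ r ∈ ent', r ∈ W), ν W * (c W - d W)) + (∑ W ∈ U.powerset.filter (fun W => (¬ ∃ r ∈ ({m} : Finset V), r ∈ W) ∧ ∃ r ∈ ent', r ∈ W), ν W * d W) + (∑ W ∈ U.powerset.filter (fun W => ∃ r ∈ ({m} : Finset V), r ∈ W), ν W * d W)) * ((∑ W ∈ U.powerset.filter (fun W => (¬ ∃ r ∈ ({m} : Finset V), r ∈ W) ∧ ∃ r ∈ ent', r ∈ W), ν W * d W * y W) + (∑ W ∈ U.powerset.filter (fun W => ∃ r ∈ ({m} : Finset V), r ∈ W), ν W * d W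 * y W)) - ((∑ W ∈ U.powerset.filter (fun W => (¬ ∃ r ∈ ({m} : Finset V), r ∈ W) ∧ ∃ r ∈ ent', r ∈ W), ν W * (c W - d W) * y W) + (∑ W ∈ U.powerset.filter (fun W => (¬ ∃ r ∈ ({m} : Finset V), r ∈ W) ∧ ∃ r ∈ ent', r ∈ W), ν W * d W * y W) + (∑ W ∈ U.powerset.filter (fun W => ∃ r ∈ ({m} : Finset V), r ∈ W), ν W * d W * y W)) * ((∑ W ∈ U.powerset.filter (fun W => ¬ ∃ r ∈ ({m} : Finset V) ∪ ent', r ∈ W), ν W * c W) + (∑ W ∈ U.powerset.filter (fun W => (¬ ∃ r ∈ ({m} : Finset V), r ∈ W) ∧ ∃ r ∈ ent', r ∈ W), ν W * d W) + (∑ W ∈ U.powerset.filter (fun W => ∃ r ∈ ({m} : Finset V), r ∈ W), ν W * d W))) * ((∑ W ∈ U.powerset.filter (fun W => (¬ ∃ r ∈ ({m} : Finset V), r ∈ W) ∧ ∃ r ∈ ent', r ∈ W), ν W * (c W - d W) * x W) + (∑ W ∈ U.powerset.filter (fun W => (¬ ∃ r ∈ ({m} : Finset V), r ∈ W) ∧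 ∃ r ∈ ent', r ∈ W), ν W * d W * x W) + (∑ W ∈ U.powerset.filter (fun W => ∃ r ∈ ({m} : Finset V), r ∈ W), ν W * d W * x W))) * (((∑ W ∈ U.powerset.filter (fun W => ∃ r ∈ ({m} : Finset V), r ∈ W), ν W * d W * x W) - (∑ W ∈ U.powerset.filter (fun W => ∃ r ∈ ({m} : Finset V), r ∈ W), ν W * d W * (x W * y W))) * ((∑ W ∈ U.powerset.filter (fun W => ∃ r ∈ ({m} : Finset V), r ∈ W), ν W * d W * y W) - (∑ W ∈ U.powerset.filter (fun W => ∃ r ∈ ({m} : Finset V), r ∈ W), ν W * d W * (x W * y W))))) :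
    (((∑ W ∈ U.powerset, ν W * chainMix {m} ent' 0 c d W) * (∑ W ∈ U.powerset, ν W * chainMix {m} ent' 1 c d W * x W) - (∑ W ∈ U.powerset, ν W * chainMix {m} ent' 0 c d W * x W) * (∑ W ∈ U.powerset, ν W * chainMix {m} ent' 1 c d W)) *
          ((∑ W ∈ U.powerset, ν W * chainMix {m} ent' 0 c d W) * (∑ W ∈ U.powerset, ν W * chainMix {m} ent' 0 c d' W * y W) - (∑ W ∈ U.powerset, ν W * chainMix {m} ent' 0 c d W * y W) * (∑ W ∈ U.powerset, ν W * chainMix {m} ent' 0 c d' W))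
        + ((∑ W ∈ U.powerset, ν W * chainMix {m} ent' 0 c d W) * (∑ W ∈ U.powerset, ν W * chainMix {m} ent' 1 c d W * y W) - (∑ W ∈ U.powerset, ν W * chainMix {m} ent' 0 c d W * y W) * (∑ W ∈ U.powerset, ν W * chainMix {m} ent' 1 c d W)) *
          ((∑ W ∈ U.powerset, ν W * chainMix {m} ent' 0 c d W) * (∑ W ∈ U.powerset, ν W * chainMix {m} ent' 0 c d' W * x W) - (∑ W ∈ U.powerset, ν W * chainMix {m} ent' 0 c d W * x W) * (∑ W ∈ U.powerset, ν W * chainMix {m} ent' 0 c d' W))) ≤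
        (∑ W ∈ U.powerset, ν W * chainMix {m} ent' 0 c d W) * ((∑ W ∈ U.powerset, ν W * chainMix {m} ent' 0 c d W) * (∑ W ∈ U.powerset, ν W * chainMix {m} ent' 0 c d W) * (∑ W ∈ U.powerset, ν W * chainMix {m} ent' 1 c d' W * (x W * y W))
          - (∑ W ∈ U.powerset, ν W * chainMix {m} ent' 0 c d W) * (∑ W ∈ U.powerset, ν W * chainMix {m} ent' 0 c d W * y W) * (∑ W ∈ U.powerset, ν W * chainMix {m} ent' 1 c d' W * x W)
          - (∑ W ∈ U.powerset, ν W * chainMix {m} ent' 0 c d W) * (∑ W ∈ U.powerset, ν W * chainMix {m} ent' 0 c d W * x W) * (∑ W ∈ U.powerset, ν W * chainMix {m} ent' 1 c d' W * y W)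
          + (∑ W ∈ U.powerset, ν W * chainMix {m} ent' 0 c d W * x W) * (∑ W ∈ U.powerset, ν W * chainMix {m} ent' 0 c d W * y W) * (∑ W ∈ U.powerset, ν W * chainMix {m} ent' 1 c d' W)) := by
  have hx0 : ∀ W, 0 ≤ x W := fun W => by rw [hx W]; split_ifs <;> norm_num
  have hy0 : ∀ W, 0 ≤ y W := fun W => by rw [hy W]; split_ifs <;> norm_num
  have hx1 : ∀ W, x W ≤ 1 := fun W => by rw [hx W]; split_ifs <;> norm_num
  have hy1 : ∀ W, y W ≤ 1 := fun W => by rw [hy W]; split_ifs <;> norm_num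
  have hxm : ∀ s t, x s ≤ x (s ∪ t) := fun s t => by
    rw [hx s, hx (s ∪ t)]
    by_cases h : j ∈ s
    · rw [if_pos h, if_pos (Finset.mem_union_left t h)]
    · rw [if_neg h]; split_ifs <;> norm_num
  have hym : ∀ s t, y s ≤ y (s ∪ t) := fun s t => by
    rw [hy s, hy (s ∪ t)]
    by_cases h : j' ∈ s
    · rw [if_pos h, if_pos (Finset.mem_union_left t h)]
    · rw [if_neg h]; split_ifs <;> norm_num
  have hxI : ∀ W, (¬ ∃ r ∈ ({m} : Finset V) ∪ ent', r ∈ W) → x W = 0 := fun W hW => by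
    rw [hx W]; exact if_neg (fun h => hW ⟨j, Finset.mem_union.2 (Or.inr hj), h⟩)
  have hyI : ∀ W, (¬ ∃ r ∈ ({m} : Finset V) ∪ ent', r ∈ W) → y W = 0 := fun W hW => by
    rw [hy W]; exact if_neg (fun h => hW ⟨j', Finset.mem_union.2 (Or.inr hj'), h⟩)
  refine chain_XA'_gate_of_parts U m j j' ent' ν c d d' hj hj' x y hx hy ?_
  rw [mg_gate_D' U m ent' ν d' hD, mg_gate_D U m ent' ν d' x hD, mg_gate_D U m ent' ν d' y hD,
    mg_gate_D U m ent' ν d' (fun W => x W * y W) hD]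
  -- the part sums
  set a := (∑ W ∈ U.powerset.filter (fun W => ¬ ∃ r ∈ ({m} : Finset V) ∪ ent', r ∈ W), ν W * c W) with ha_def
  set δ := (∑ W ∈ U.powerset.filter (fun W => (¬ ∃ r ∈ ({m} : Finset V), r ∈ W) ∧ ∃ r ∈ ent', r ∈ W), ν W * (c W - d W)) with hδ_def
  set u := (∑ W ∈ U.powerset.filter (fun W => (¬ ∃ r ∈ ({m} : Finset V), r ∈ W) ∧ ∃ r ∈ ent', r ∈ W), ν W * d W) with hu_def
  set t := (∑ W ∈ U.powerset.filter (fun W => ∃ r ∈ ({m} : Finset V), r ∈ W), ν W * d W) with ht_def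
  set XJ := (∑ W ∈ U.powerset.filter (fun W => (¬ ∃ r ∈ ({m} : Finset V), r ∈ W) ∧ ∃ r ∈ ent', r ∈ W), ν W * (c W - d W) * x W) with hXJ_def
  set XU := (∑ W ∈ U.powerset.filter (fun W => (¬ ∃ r ∈ ({m} : Finset V), r ∈ W) ∧ ∃ r ∈ ent', r ∈ W), ν W * d W * x W) with hXU_def
  set XM := (∑ W ∈ U.powerset.filter (fun W => ∃ r ∈ ({m} : Finset V), r ∈ W), ν W * d W * x W) with hXM_def
  set YJ := (∑ W ∈ U.powerset.filter (fun W => (¬ ∃ r ∈ ({m} : Finset V), r ∈ W) ∧ ∃ r ∈ ent', r ∈ W), ν W * (c W - d W) * y W) with hYJ_def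
  set YU := (∑ W ∈ U.powerset.filter (fun W => (¬ ∃ r ∈ ({m} : Finset V), r ∈ W) ∧ ∃ r ∈ ent', r ∈ W), ν W * d W * y W) with hYU_def
  set YM := (∑ W ∈ U.powerset.filter (fun W => ∃ r ∈ ({m} : Finset V), r ∈ W), ν W * d W * y W) with hYM_def
  set XYM := (∑ W ∈ U.powerset.filter (fun W => ∃ r ∈ ({m} : Finset V), r ∈ W), ν W * d W * (x W * y W)) with hXYM_def
  set wM := (∑ W ∈ U.powerset.filter (fun W => ∃ r ∈ ({m} : Finset V), r ∈ W), ν W * d' W) with hwM_def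
  set XWM := (∑ W ∈ U.powerset.filter (fun W => ∃ r ∈ ({m} : Finset V), r ∈ W), ν W * d' W * x W) with hXWM_def
  set YWM := (∑ W ∈ U.powerset.filter (fun W => ∃ r ∈ ({m} : Finset V), r ∈ W), ν W * d' W * y W) with hYWM_def
  set XYWM := (∑ W ∈ U.powerset.filter (fun W => ∃ r ∈ ({m} : Finset V), r ∈ W), ν W * d' W * (x W * y W)) with hXYWM_def
  have hcd0 : ∀ W, 0 ≤ c W - d W := fun W => by linarith [hdc W]
  have ha : 0 ≤ a := Finset.sum_nonneg (fun W _ => mul_nonneg (hν0 W) (hc0 W))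
  have hδ : 0 ≤ δ := Finset.sum_nonneg (fun W _ => mul_nonneg (hν0 W) (hcd0 W))
  have hu : 0 ≤ u := Finset.sum_nonneg (fun W _ => mul_nonneg (hν0 W) (hd0 W))
  have ht : 0 ≤ t := Finset.sum_nonneg (fun W _ => mul_nonneg (hν0 W) (hd0 W))
  have hXJ : 0 ≤ XJ := Finset.sum_nonneg (fun W _ => mul_nonneg (mul_nonneg (hν0 W) (hcd0 W)) (hx0 W))
  have hXU : 0 ≤ XU := Finset.sum_nonneg (fun W _ => mul_nonneg (mul_nonneg (hν0 W) (hd0 W)) (hx0 W))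
  have hXM : 0 ≤ XM := Finset.sum_nonneg (fun W _ => mul_nonneg (mul_nonneg (hν0 W) (hd0 W)) (hx0 W))
  have hYJ : 0 ≤ YJ := Finset.sum_nonneg (fun W _ => mul_nonneg (mul_nonneg (hν0 W) (hcd0 W)) (hy0 W))
  have hYU : 0 ≤ YU := Finset.sum_nonneg (fun W _ => mul_nonneg (mul_nonneg (hν0 W) (hd0 W)) (hy0 W))
  have hYM : 0 ≤ YM := Finset.sum_nonneg (fun W _ => mul_nonneg (mul_nonneg (hν0 W) (hd0 W)) (hy0 W))
  have hXYM : 0 ≤ XYM := Finset.sum_nonneg (fun W _ => mul_nonneg (mul_nonneg (hν0 W) (hd0 W)) (mul_nonneg (hx0 W) (hy0 W)))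
  have hXJδ : XJ ≤ δ := Finset.sum_le_sum (fun W _ => mul_le_of_le_one_right (mul_nonneg (hν0 W) (hcd0 W)) (hx1 W))
  have hYJδ : YJ ≤ δ := Finset.sum_le_sum (fun W _ => mul_le_of_le_one_right (mul_nonneg (hν0 W) (hcd0 W)) (hy1 W))
  have hXUu : XU ≤ u := Finset.sum_le_sum (fun W _ => mul_le_of_le_one_right (mul_nonneg (hν0 W) (hd0 W)) (hx1 W))
  have hYUu : YU ≤ u := Finset.sum_le_sum (fun W _ => mul_le_of_le_one_right (mul_nonneg (hν0 W) (hd0 W)) (hy1 W))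
  have hXMt : XM ≤ t := Finset.sum_le_sum (fun W _ => mul_le_of_le_one_right (mul_nonneg (hν0 W) (hd0 W)) (hx1 W))
  have hYMt : YM ≤ t := Finset.sum_le_sum (fun W _ => mul_le_of_le_one_right (mul_nonneg (hν0 W) (hd0 W)) (hy1 W))
  have hXYMx : XYM ≤ XM := Finset.sum_le_sum (fun W _ => by
    calc ν W * d W * (x W * y W) = (ν W * d W * x W) * y W := by ring
      _ ≤ ν W * d W * x W := mul_le_of_le_one_right (mul_nonneg (mul_nonneg (hν0 W) (hd0 W)) (hx0 W)) (hy1 W))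
  have hXYMy : XYM ≤ YM := Finset.sum_le_sum (fun W _ => by
    calc ν W * d W * (x W * y W) = (ν W * d W * y W) * x W := by ring
      _ ≤ ν W * d W * y W := mul_le_of_le_one_right (mul_nonneg (mul_nonneg (hν0 W) (hd0 W)) (hy0 W)) (hx1 W))
  -- the ideal carries no marker
  have hIx : (∑ W ∈ U.powerset.filter (fun W => ¬ ∃ r ∈ ({m} : Finset V) ∪ ent', r ∈ W), ν W * c W * x W) = 0 :=
    cgate_sum_zero U _ _ (fun W hW => by rw [hxI W hW, mul_zero])
  have hIy : (∑ W ∈ U.powerset.filter (fun W => ¬ ∃ r ∈ ({m} : Finset V) ∪ ent', r ∈ W), ν W * c W * y W) = 0 :=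
    cgate_sum_zero U _ _ (fun W hW => by rw [hyI W hW, mul_zero])
  -- the Holley facts of the five corners
  have FJUx := cg_fact_JU' U {m} ent' ν c d hν0 hν hc0 hd0 hdc hcd hratio x hx0 hxm
  have FJMx := cg_fact_JM' U {m} ent' ν c d hν0 hν hc0 hd0 hdc hcd hratio x hx0 hxm
  have FJUy := cg_fact_JU' U {m} ent' ν c d hν0 hν hc0 hd0 hdc hcd hratio y hy0 hym
  have FJMy := cg_fact_JM' U {m} ent' ν c d hν0 hν hc0 hd0 hdc hcd hratio y hy0 hym
  rw [cg_entfree_piecewise U {m} ent' ν c d x, cg_entfree_piecewise' U {m} ent' ν c d, hIx, zero_add] at FJUx FJMx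
  rw [cg_entfree_piecewise U {m} ent' ν c d y, cg_entfree_piecewise' U {m} ent' ν c d, hIy, zero_add] at FJUy FJMy
  have FMx := cg_fact_McM U {m} ent' ν c d hν0 hν hc0 hd0 hcd x hx0 hxm
  have FMy := cg_fact_McM U {m} ent' ν c d hν0 hν hc0 hd0 hcd y hy0 hym
  have FM2 := cg_fact_McM2 U {m} ent' ν c d hν0 hν hc0 hd0 hcd x y hx0 hy0 hxm hym
  have FM2' := cg_fact_McM2 U {m} ent' ν c d hν0 hν hc0 hd0 hcd y x hy0 hx0 hym hxm
  rw [sum_entfree_split U {m} ent' (fun W => ν W * c W), cg_split' U ν c d (fun W => (¬ ∃ r ∈ ({m} : Finset V), r ∈ W) ∧ ∃ r ∈ ent', r ∈ W), cg_split U ν c d (fun W => (¬ ∃ r ∈ ({m} : Finset V), r ∈ W) ∧ ∃ r ∈ ent', r ∈ W) x] at FMx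
  rw [sum_entfree_split U {m} ent' (fun W => ν W * c W), cg_split' U ν c d (fun W => (¬ ∃ r ∈ ({m} : Finset V), r ∈ W) ∧ ∃ r ∈ ent', r ∈ W), cg_split U ν c d (fun W => (¬ ∃ r ∈ ({m} : Finset V), r ∈ W) ∧ ∃ r ∈ ent', r ∈ W) y] at FMy
  rw [sum_entfree_split U {m} ent' (fun W => ν W * c W), cg_split' U ν c d (fun W => (¬ ∃ r ∈ ({m} : Finset V), r ∈ W) ∧ ∃ r ∈ ent', r ∈ W), cg_split U ν c d (fun W => (¬ ∃ r ∈ ({m} : Finset V), r ∈ W) ∧ ∃ r ∈ ent', r ∈ W) y] at FM2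
  rw [sum_entfree_split U {m} ent' (fun W => ν W * c W), cg_split' U ν c d (fun W => (¬ ∃ r ∈ ({m} : Finset V), r ∈ W) ∧ ∃ r ∈ ent', r ∈ W), cg_split U ν c d (fun W => (¬ ∃ r ∈ ({m} : Finset V), r ∈ W) ∧ ∃ r ∈ ent', r ∈ W) x] at FM2'
  have eyx : ∑ W ∈ U.powerset.filter (fun W => ∃ r ∈ ({m} : Finset V), r ∈ W), ν W * d W * (y W * x W) = XYM :=
    Finset.sum_congr rfl (fun W _ => by ring)
  rw [eyx] at FM2'
  -- the surviving-vs-sure-entered facts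
  have FBx := cg_fact_BB U {m} ent' ν d hν0 hν hd0 hdd x hx0 hxm
  have FBy := cg_fact_BB U {m} ent' ν d hν0 hν hd0 hdd y hy0 hym
  have FB2 := cg_fact_BB2 U {m} ent' ν d hν0 hν hd0 hdd y x hy0 hx0 hym hxm
  have FB2' := cg_fact_BB2 U {m} ent' ν d hν0 hν hd0 hdd x y hx0 hy0 hxm hym
  rw [sum_entfree_split U {m} ent' (fun W => ν W * d W)] at FBx FBy FB2 FB2'
  rw [eyx] at FB2
  have hBI : (∑ W ∈ U.powerset.filter (fun W => ¬ ∃ r ∈ ({m} : Finset V) ∪ ent', r ∈ W), ν W * d W) ≤ a :=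
    Finset.sum_le_sum (fun W _ => mul_le_mul_of_nonneg_left (hdc W) (hν0 W))
  have hBx : 0 ≤ XM * (a + u) - XU * t := by
    have h := mul_le_mul_of_nonneg_right hBI hXM
    linarith only [FBx, h]
  have hBy : 0 ≤ YM * (a + u) - YU * t := by
    have h := mul_le_mul_of_nonneg_right hBI hYM
    linarith only [FBy, h]
  have hBB2 : 0 ≤ XYM * (a + u) - YU * XM := by
    have h := mul_le_mul_of_nonneg_right hBI hXYM
    linarith only [FB2, h]
  have hBB2' : 0 ≤ XYM * (a + u) - XU * YM := by
    have h := mul_le_mul_of_nonneg_right hBI hXYM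
    linarith only [FB2', h]
  have FMM := cg_fact_MM U ν d hν0 hν hd0 hdd m x y hx0 hy0 hxm hym
  -- the killed-vs-sure-entered two-marker facts
  have FIMx := mg_fact_IM U {m} ent' j j' ν c d hν0 hν hc0 hd0 hdc hcd hratio x y hx hy
  have FIMy := mg_fact_IM U {m} ent' j' j ν c d hν0 hν hc0 hd0 hdc hcd hratio y x hy hx
  have ePx : (∑ W ∈ U.powerset.filter (fun W => ¬ ∃ r ∈ ({m} : Finset V), r ∈ W), ν W * (if ∃ r ∈ ent', r ∈ W then c W - d W else c W) * (1 - x W)) = a + δ - XJ := by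
    have h1 : (∑ W ∈ U.powerset.filter (fun W => ¬ ∃ r ∈ ({m} : Finset V), r ∈ W), ν W * (if ∃ r ∈ ent', r ∈ W then c W - d W else c W) * (1 - x W)) =
        (∑ W ∈ U.powerset.filter (fun W => ¬ ∃ r ∈ ({m} : Finset V), r ∈ W), ν W * (if ∃ r ∈ ent', r ∈ W then c W - d W else c W)) - (∑ W ∈ U.powerset.filter (fun W => ¬ ∃ r ∈ ({m} : Finset V), r ∈ W), ν W * (if ∃ r ∈ ent', r ∈ W then c W - d W else c W) * x W) := by
      rw [← Finset.sum_sub_distrib]; exact Finset.sum_congr rfl (fun W _ => by ring)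
    rw [h1, cg_entfree_piecewise U {m} ent' ν c d x, cg_entfree_piecewise' U {m} ent' ν c d, hIx]; ring
  have ePy : (∑ W ∈ U.powerset.filter (fun W => ¬ ∃ r ∈ ({m} : Finset V), r ∈ W), ν W * (if ∃ r ∈ ent', r ∈ W then c W - d W else c W) * (1 - y W)) = a + δ - YJ := by
    have h1 : (∑ W ∈ U.powerset.filter (fun W => ¬ ∃ r ∈ ({m} : Finset V), r ∈ W), ν W * (if ∃ r ∈ ent', r ∈ W then c W - d W else c W) * (1 - y W)) =
        (∑ W ∈ U.powerset.filter (fun W => ¬ ∃ r ∈ ({m} : Finset V), r ∈ W), ν W * (if ∃ r ∈ ent', r ∈ W then c W - d W else c W)) - (∑ W ∈ U.powerset.filter (fun W => ¬ ∃ r ∈ ({m} : Finset V), r ∈ W), ν W * (if ∃ r ∈ ent', r ∈ W then c W - d W else c W) * y W) := by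
      rw [← Finset.sum_sub_distrib]; exact Finset.sum_congr rfl (fun W _ => by ring)
    rw [h1, cg_entfree_piecewise U {m} ent' ν c d y, cg_entfree_piecewise' U {m} ent' ν c d, hIy]; ring
  rw [ePx, mg_cell0y' U _ (fun W => ν W * d W) x y] at FIMx
  rw [ePy, mg_cell0y' U _ (fun W => ν W * d W) y x, eyx] at FIMy
  -- the gate's cell facts
  have G0x := mg_fact_ratio0x U m j j' ν d d' hν0 hν hd0 hd'0 hdd' x y hx hy
  have G0y := mg_fact_ratio0x U m j' j ν d d' hν0 hν hd0 hd'0 hdd' y x hy hx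
  have Gx := mg_fact_ratiox U m j j' ν d d' hν0 hν hd0 hd'0 hdd' x y hx hy
  have Gy := mg_fact_ratiox U m j' j ν d d' hν0 hν hd0 hd'0 hdd' y x hy hx
  have Ghyp := mg_fact_hyp U m j j' ν d' hν0 hν hd'0 hd'd' x y hx hy
  have eyx' : ∑ W ∈ U.powerset.filter (fun W => ∃ r ∈ ({m} : Finset V), r ∈ W), ν W * d' W * (y W * x W) = XYWM :=
    Finset.sum_congr rfl (fun W _ => by ring)
  have eyx00 : ∑ W ∈ U.powerset.filter (fun W => ∃ r ∈ ({m} : Finset V), r ∈ W), ν W * d' W * ((1 - y W) * (1 - x W)) = ∑ W ∈ U.powerset.filter (fun W => ∃ r ∈ ({m} : Finset V), r ∈ W), ν W * d' W * ((1 - x W) * (1 - y W)) :=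
    Finset.sum_congr rfl (fun W _ => by ring)
  have eyx00d : ∑ W ∈ U.powerset.filter (fun W => ∃ r ∈ ({m} : Finset V), r ∈ W), ν W * d W * ((1 - y W) * (1 - x W)) = ∑ W ∈ U.powerset.filter (fun W => ∃ r ∈ ({m} : Finset V), r ∈ W), ν W * d W * ((1 - x W) * (1 - y W)) :=
    Finset.sum_congr rfl (fun W _ => by ring)
  rw [mg_cell00 U _ (fun W => ν W * d' W) x y, mg_cellx0 U _ (fun W => ν W * d W) x y,
    mg_cell00 U _ (fun W => ν W * d W) x y, mg_cellx0 U _ (fun W => ν W * d' W) x y] at G0x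
  rw [eyx00, eyx00d, mg_cell00 U _ (fun W => ν W * d' W) x y, mg_cellx0 U _ (fun W => ν W * d W) y x,
    mg_cell00 U _ (fun W => ν W * d W) x y, mg_cellx0 U _ (fun W => ν W * d' W) y x, eyx, eyx'] at G0y
  rw [mg_cellx0 U _ (fun W => ν W * d' W) x y, mg_cellx0 U _ (fun W => ν W * d W) x y] at Gx
  rw [mg_cellx0 U _ (fun W => ν W * d' W) y x, mg_cellx0 U _ (fun W => ν W * d W) y x, eyx, eyx'] at Gy
  rw [mg_cellx0 U _ (fun W => ν W * d' W) x y, mg_cell0y U _ (fun W => ν W * d' W) x y,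
    mg_cell00 U _ (fun W => ν W * d' W) x y] at Ghyp
  rw [mg_cell00 U _ (fun W => ν W * d W) x y] at hbpos
  rw [mg_cellx0 U _ (fun W => ν W * d W) x y] at hb1pos
  rw [mg_cell0y U _ (fun W => ν W * d W) x y] at hb2pos
  have hr0 : 0 ≤ wM - XWM - YWM + XYWM := by
    rw [← mg_cell00 U _ (fun W => ν W * d' W) x y]
    exact Finset.sum_nonneg (fun W _ => mul_nonneg (mul_nonneg (hν0 W) (hd'0 W)) (mul_nonneg (sub_nonneg.2 (hx1 W)) (sub_nonneg.2 (hy1 W))))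
  have hω : XYWM ≤ XYM := Finset.sum_le_sum (fun W _ => mul_le_mul_of_nonneg_right (mul_le_mul_of_nonneg_left (hd'd W) (hν0 W)) (mul_nonneg (hx0 W) (hy0 W)))
  -- the reduction
  have key := mgate_of_mminus a δ u t XJ XU XM YJ YU YM XYM (wM - XWM - YWM + XYWM) (XWM - XYWM) (YWM - XYWM) XYWM
    ha hδ hu ht hXJ hXU hXM hYJ hYU hYM hXYM
    (by linear_combination FJUx) (by linear_combination FJMx) (by linear_combination FMx)
    (by linear_combination FJUy) (by linear_combination FJMy) (by linear_combination FMy)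
    (by linear_combination FM2) (by linear_combination FM2') hBx hBy hBB2 hBB2' (by linear_combination FMM)
    (by linear_combination FIMx) (by linear_combination FIMy)
    (sub_nonneg.2 hXJδ) (sub_nonneg.2 hXUu) (sub_nonneg.2 hXMt) (sub_nonneg.2 hYJδ) (sub_nonneg.2 hYUu) (sub_nonneg.2 hYMt)
    (sub_nonneg.2 hXYMx) (sub_nonneg.2 hXYMy)
    HMM hbpos hb1pos hb2pos hb12pos hr0 (by linear_combination G0x) (by linear_combination G0y)
    (by linear_combination Gx) (by linear_combination Gy) hω (by linear_combination Ghyp)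
  linear_combination key

end MGateChainMain

end Summit.Ventures.PercRepro2.Coin
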